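import Summits.Langlands.Langlands.Theorems.AdjointCellSplit
import Summits.Langlands.Langlands.Theorems.PhaseMomentSplitHeart

/-!
# `PhaseMomentSplit` — lens-4 («minimal counterexample / extremal reduction») g34 node, RESIDUAL MODE — Theorems twin (census landing form: no bare `closes`, summit-consuming certificates private)

«OFF THE EXACT CELL THE LOST INFORMATION IS A ROOT OF UNITY — AND FOUR MOMENTS OF π'S OWN SYMMETRIC POWERS CANNOT LIVE ON ROOTS OF UNITY OF
ORDER ≤ 5.  STRONG ARTIN LEAVES THE DIHEDRAL CELL.»

TARGET (BY NAME) = DCD = tree `Theorems.AdjointCellSplit.DihedralCandidateDescent` (lens-4 g33 node, Theorems twin p829228, crit row 450 CLEARED;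
DCD = IMP (`Theorems.PhaseTwistSplit.ImprimitiveCandidateRigidity`, g30's residual of RIGID = stmt-Langlands-27355 of route-Langlands-PerfectLayerClifford)
at rank 2 on the DIHEDRAL CELL, WITH strong Artin over `K` (`RegularShadowSplit.StrongArtinOver K`) as antecedent; g33 tag «ATTACKABLE-NOW given SART;
unconditional in print only for `K = ℚ` on non-totally-real `A₅`-layers»).  DCD says: a cuspidal L-algebraic `π` on `GL₂/K` whose relative avatar
`r : Γ_L → GL₂(ℚ̄_ℓ)` (irreducible) along a Galois layer `L/K` with no cyclic sub-layer of prime degree is also satisfied by the restriction of a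
semisimple `ρ₀ : Γ_K → GL₂` REDUCIBLE ON SOME QUADRATIC FIELD `M` has an avatar over `K` — granted strong Artin over `K`.

LENS-4 READING.  g33 destroyed the minimal counterexample on the EXACT Chebotarev cell (places split in `L`, where `Sat(t_{π,v}) = charpoly ρ₀(Frob_v)`)
by pricing the adjoint trace against the ARTIN FORMS of `Gal(ML/K) ≅ C₂ × G` — importing strong Artin for the layer group, which for
`G = A₆, 2⁴⋊A₅, SL₂(𝔽₅)` (even), … is as open as the summit.  The extremal move of g34: a minimal counterexample must also survive at the INEXACT
places — `v` inert in `M` with `Frob_v ↦ (c, h)`, `ord h = f` — where the relation holds only through `f`-th POWERS.  There the lost information is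
EXACTLY an `f`-th root of unity: `ρ₀(Frob_v)` is antidiagonal with eigenvalues `{γ, −γ}`, so `{t₁^f, t₂^f} = {γ^f, (−γ)^f}`, `ζ_v := −t₁/t₂` satisfies
`ζ_v^f = 1`, and the ADJOINT TRACE `X_v := t₁/t₂ + 1 + t₂/t₁ = 1 − ζ_v − ζ_v⁻¹` is CONFINED to the finite set `V_f = {1 − 2cos(2πk/f)}` (kernel:
`phase_of_powers`; `V_1 = {−1}` is g33's exact cell; `V_2 = {−1,3}`, `V_3 = {−1,2}`, `V_4 = {−1,1,3}`, `V_5 = {−1,(3∓√5)/2}`: kernel `support_one … support_five`,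
`support_six`, `support_ten`).  On the other side, the distribution of `X_v` over the inert places is controlled up to DEGREE FOUR by the Rankin–Selberg
theory of `π`'s OWN lifts `ad π` (`GL₃`, Gelbart–Jacquet) and `A⁴π := Sym⁴π ⊗ ω_π⁻²` (`GL₅`, Kim) — NO Artin form, NO strong Artin: its moments are the
`SO(3)` Sato–Tate moments `E[X^j] = 1, 0, 1, 1, 3`.  A finite group whose ORDER SPECTRUM cannot carry those moments on `⋃_f V_f` with its class masses —
a PHASE-MOMENT CERTIFICATE, `PhaseMomentCertificate G`, an LP in `5 + #ord(G)` unknowns, KERNEL-CERTIFIED for every group of spectrum `⊆ {1,…,5}`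
(`A₅`, `A₆ ≅ PSL₂(9)`, `2⁴⋊A₅`, …: `cert_of_orderOf_le_five`, `P = (x+1)(x−2)(x²−3x+1) ≥ 0` on `V_1 ∪ … ∪ V_5`, `∫P dμ_ST = −1`) and for the binary
icosahedral statistics (`SL₂(𝔽₅)`: `cert_of_binaryIcosahedral_stats`, `P⁎ = x⁴−5x³+5x²+5x−5`, the inequality is `√5 < 5/2`) — admits NO counterexample:
`π` is forced to be solvable polyhedral, hence HAS an avatar.  The observable `X_v` is invariant under `t ↦ c·t` and `t ↦ t⁻¹`, so neither the
unitary/algebraic normalisation of `π` nor the arithmetic/geometric Frobenius convention of `arithFrobPolyOfSatake` enters.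

## Mechanism (paper proof (a′) of DCD°; complete modulo the cited print theorems; ≈ 1 page; NO strong Artin)

SETTING (as g33 COMMON).  `G := Gal(L/K)` is perfect (no prime cyclic quotient).  `r ≅ ρ₀|_{Γ_L}` (both semisimple with the same characteristic
polynomials a.e.: Chebotarev over `L` + Brauer–Nesbitt), so `ρ₀` is irreducible; `¬ QuadIrreducible K ρ₀` gives a quadratic `M/K` with `ρ₀|_{Γ_M}`
reducible, hence `ρ₀ ≅ Ind_{Γ_M}^{Γ_K} χ₀` (Clifford) and `Tr ρ₀ = 0` off `Γ_M` (g33 kernel `trace_antidiagonal`, `det_antidiagonal`); `M ⊄ L`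
(else `G ↠ C₂`), so `Gal(ML/K) ≅ C₂ × G`; `η :=` the quadratic character of `M/K`.  Let `π^u := π ⊗ |det|^{w}` be the unitary twist; `X_v` is the same for
`π` and `π^u`.  EXITS: if `π^u` is SOLVABLE POLYHEDRAL it has an avatar and we are done — DIHEDRAL (`π^u ≅ π^u ⊗ η'`): `π^u = AI(ψ)`, `ψ` algebraic since `π` is
L-algebraic, avatar `Ind ψ_λ` (Labesse–Langlands 1979; Weil 1956; exactly as g33 (a)); TETRAHEDRAL (`Sym³` not cuspidal): `π^u ≅ π(σ)` for a
`2`-dimensional representation `σ` of `W_K` of tetrahedral type (Kim–Shahidi, Ann. Math. 155 (2002), Lemma 6.5, p. 873 [corpus:paper:kim2002-functorial-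
products-gl-2-gl-3-symmetric p.37]); OCTAHEDRAL (`Sym³` cuspidal, `Sym⁴` not): `π^u ≅ π(σ)`, `σ` octahedral (Kim–Shahidi, Duke 112 (2002), Prop. 3.3.8,
p. 186 [corpus:paper:doi-10-1215-s0012-9074-02-11215-0 p.10]); in both cases `σ = σ₀ ⊗ χ` with `σ₀` ARTIN (projectively finite; Tate) and `χ` a Hecke
character, algebraic because `π` and `π(σ₀)` are L-algebraic, so `ι⁻¹σ₀ ⊗ χ_λ` is a semisimple avatar of `π`, Satake–Frobenius compatible a.e.
So ASSUME `π^u` is not solvable polyhedral.  Then `Π₁ := ad π^u = Sym²π^u ⊗ ω⁻¹` is unitary CUSPIDAL on `GL₃/K` (Gelbart–Jacquet 1978, Thm 9.3) and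
`Π₂ := A⁴π^u = Sym⁴π^u ⊗ ω⁻²` is automorphic (Kim, J. AMS 16 (2003)) and unitary CUSPIDAL on `GL₅/K` (Kim–Shahidi, Duke 112, Thm 3.3.7); both are
self-dual with trivial central character; `Π₀ := 1`.  Their Dirichlet coefficients at an unramified `v` are `1`, `X_v`, `Y_v := X_v² − X_v − 1`
(Clebsch–Gordan; kernel `sym4Trace_eq`).

STEP 1 (the phase; Galois side).  For all but finitely many `v` inert in `M` (unramified in `ML`, outside the bad set of `π`, below every `w` at which
the two a.e. relations hold): `X_v ∈ V_{f(v)}`, `f(v) := ord(Frob_v|_L) = f(w|v)`  [eigenvalues of `ρ₀(Frob_v)^{f} = r(Frob_w)` are `{t₁^f, t₂^f}` by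
the relation and `{γ^f, (−γ)^f}` by the induced shape; `t₂ ≠ 0` since `t₁t₂ = ω(ϖ_v)`; kernel `phase_of_powers`].  Free of charge: `|t₁| = |t₂| = 1`
for `π^u` at these places (TEMPERED), since `ζ_v` is a root of unity and `|t₁t₂| = 1`.

STEP 2 (even prime powers cancel; automorphic side).  For `i, j ∈ {0,1,2}` put
  `Δ_{ij}(s) := log L^S(s, Π_i × Π_j) − log L^S(s, Π_i × (Π_j ⊗ η)) = Σ_{v ∉ S} Σ_{k ≥ 1} c_i(v^k) c_j(v^k) (1 − η_v^k) / (k q_v^{ks})`   (`s > 1` real).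
At `v` split in `M`, `η_v = 1`: every term vanishes.  At `v` inert, `η_v = −1`: the EVEN `k` vanish and the odd `k` carry the factor `2`; the odd
`k ≥ 3` contribute `O(1)` uniformly as `s → 1⁺` because `Π_{i,v}` is tempered there (Step 1: `|c_i(v^k)| ≤ dim Π_i`, and `Σ_v q_v^{−3} < ∞`).  Hence
  `Δ_{ij}(s) = 2 Σ_{v inert} c_i(v) c_j(v) q_v^{−s} + O(1)`  — NO bound towards Ramanujan is used anywhere (the non-tempered places are split and cancel).
Poles: `Π_i`, `Π_j`, `Π_j ⊗ η` are unitary cuspidal, so `log L^S(s, Π_i × Π') = δ(Π' ≅ Π̃_i) · log(1/(s−1)) + O(1)` as `s → 1⁺` (simple pole iff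
`Π' ≅ Π̃_i`: Jacquet–Shalika, Amer. J. Math. 103 (1981), (II) Thm 4.8 with (I) Prop. 3.6; holomorphy and NON-VANISHING at `s = 1` otherwise: Shahidi,
Amer. J. Math. 103 (1981), Thm 5.2).  `Π_j ⊗ η ≇ Π_i`: different ranks for `i ≠ j`, and for `i = j` the central characters differ (`η³ = η⁵ = η ≠ 1`).
Therefore, with `E[φ] := lim_{s→1⁺} (2/log(1/(s−1))) Σ_{v inert} φ_v q_v^{−s}` (which exists for the six products):
  `E[1] = 1,  E[X] = 0,  E[X²] = 1,  E[Y] = 0,  E[XY] = 0,  E[Y²] = 1`,   hence   `(E[X^j])_{j ≤ 4} = (1, 0, 1, 1, 3) =: m`   (kernel `stMoment_of_poles`;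
`E[Y] = 0` is the consistency check `pole_Y1_consistent`).  These are the moments of `1 + 2cos θ` under Sato–Tate on `SO(3)` — but only the six pole
orders are used.

STEP 3 (the certificate bites).  Let `(P, κ)` be a phase-moment certificate of `G`: `κ_f ≤ P` on `V_f` for every `f ∈ ord(G)` and
`(Σ_j p_j m_j)·|G| < Σ_{g ∈ G} κ_{ord g}`.  For real `s > 1`, termwise by Step 1 (finitely many exceptions are `O(1)`):
  `Σ_{v inert} P(X_v) q_v^{−s} ≥ Σ_f κ_f · Σ_{v inert, f(v) = f} q_v^{−s} + O(1) = (Σ_f κ_f μ_f / 2) · log(1/(s−1)) + O(1)`,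
`μ_f := #{g ∈ G : ord g = f}/|G|`, by Chebotarev in `Gal(ML/K) = C₂ × G` (Dirichlet-density form; `{(c,g) : ord g = f}` is a union of classes of mass
`μ_f/2`).  The left side is `(Σ_j p_j m_j / 2) · log(1/(s−1)) + O(1)` by Step 2 (`deg P ≤ 4`).  Dividing by `log(1/(s−1)) → ∞`:
`Σ_j p_j m_j ≥ Σ_f μ_f κ_f`, i.e. `(Σ_j p_j m_j)·|G| ≥ Σ_g κ_{ord g}` — contradicting the certificate (kernel `certificate_absurd`).  So `π^u` IS solvable
polyhedral and the EXITS give the avatar.  ∎   (If Langlands holds the cell is in fact dihedral: `ρ_π|_{Γ_L} ≅ ρ₀|_{Γ_L}` irreducible and `G` perfect force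
`ρ_π ≅ ρ₀`; (a′) proves the weaker «solvable polyhedral», which is all DCD asks.)

CERTIFIED CLASSES (for which DCD° is thereby a theorem modulo print and modulo Lean debt, for EVERY base field `K` and EVERY such layer — totally real /
even layers included, where no modularity lifting or potential automorphy applies, and `A₆`-layers, which carry no `2`-dimensional projective
representation at all so that g33's pricing has nothing to stand on): KERNEL — every finite `G` with all element orders `≤ 5` (`A₅`; `A₆`; `2⁴⋊A₅`;
any perfect group of spectrum `⊆ {1,…,5}`), and every `G` with the order statistics of `SL₂(𝔽₅)` (`120; 24, 20, 24` elements of order `5, 6, 10`);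
INSTRUMENT (float LP, exact certificate not extracted — honest flag 4): `PSL₂(7)` (dual margin `0.2085`), `PSL₂(11)` (`0.0245`).  UNCERTIFIED at degree 4
(LP feasible — the method is SILENT, not refuted): `A₇`, `SL₂(7)`, `PSL₂(8)`, `PSL₂(13)`, `SL₂(9)`, `A₅ × A₅`, `M₁₁` (instrument I-g34.1: `lp/lp3.out`).

## Pieces (DCD ⟸ DCD° ∧ DCD_res; kernel `closes_target`, 0 sorry)

* DCD° `CertifiedDihedralDescent` [new · crux r2 · STRONG-ARTIN-FREE · ATTACKABLE-NOW: (a′)] = DCD's text with `StrongArtinOver K →` DELETED and the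
  antecedent `PhaseMomentCertificate (L ≃ₐ[K] L) →` inserted in its place.  WEAKER than IMP and RIGID (`dcd0_of_imp`, `dcd0_of_rigid`), S-implied
  (`dcd0_of_langlands`, private); NOT weaker than DCD (it drops DCD's strong-Artin hypothesis — that is the content) and not cheaply
  stronger (probes).  `certified_branch` spells out the SART-free binder list it delivers.
* DCD_res `UncertifiedDihedralDescent` [new · declared RESIDUAL of the lever · UNDECIDED SART-free] = DCD VERBATIM with the single antecedent
  `¬ PhaseMomentCertificate (L ≃ₐ[K] L) →` inserted.  WEAKER than DCD (`dcdres_of_dcd`), hence than IMP/RIGID/S; it KEEPS DCD's strong-Artin antecedent, so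
  g33's adjoint-cell pricing (a) still decides it given SART — the node loses nothing of g33's attack; what is open is deciding it WITHOUT strong Artin
  (idea needed: degree `≥ 5` information = `Sym^{≥5}` / `GL₂ × GL₂ × GL₂` functoriality, bc9).
* Kernel (§2–§3): `closes_target : DCD° → DCD_res → DCD` BY NAME (cases on the certificate; in the certified branch DCD's `StrongArtinOver K` is NOT
  USED); `dcdres_of_dcd`, `dcd0_of_imp`, `dcdres_of_imp`, `dcd0_of_rigid`, `dcdres_of_rigid`, `*_of_langlands`, `pieces_of_imp`; host edges BY NAME
  through the g33 kernel: `closes_imp` (IMP), `closes_rigid` (tree RIGID), `closes_item` (stmt-Langlands-27355 `Theses.PerfectLayerClifford.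
  PerfectLayerRigidity`), `closes_route` (host leaf `GaloisHullLift.PerfectHullDescent` 28225 with EXT/FINTYPE/RED°).
* Decided heart (§4, kernel-certified): `PhaseSupport`, `PhaseMomentCertificate` (finite-group/real-algebra data: `0 < |G|`, `κ_{ord g} ≤ P` on
  `V_{ord g}`, `(Σ p_j m_j)|G| < Σ_g κ_{ord g}`); root-of-unity identities `support_one/two/three/four/five/six/ten` (e.g. `ζ³(x+1)(x²−3x+1) = −(ζ−1)(ζ⁵−1)`,
  `ζ⁶(x+1)(x−3)(x²−3x+1)(x²−x−1) = (ζ²−1)(ζ¹⁰−1)`); `cert_of_orderOf_le_five` (THE ICOSAHEDRAL CLASS IS MOMENT-RIGID); `cert_of_binaryIcosahedral_stats`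
  (the binary icosahedral class is moment-rigid: `P⁎`, `kappaB √5`, `−240 < −120 − 48√5`); `phase_of_powers` (Galois side of Step 1); `sym4Trace_eq`
  (Clebsch–Gordan `Y = X² − X − 1`); `stMoment_of_poles` + `pole_Y1_consistent` (Step 2 bookkeeping); `certificate_absurd` (Step 3 logic).

## Honest flags

1. LEAN DEBT (plan-only, none of it in `Literature/` today): Rankin–Selberg `L^S(s, Π × Π')` for `GL₃, GL₅` pairs with the Jacquet–Shalika pole criterion
   and Shahidi's non-vanishing at `s = 1`; Gelbart–Jacquet; Kim's `Sym⁴`; the Kim–Shahidi cuspidality criterion (Thm 3.3.7) and the tetrahedral/octahedral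
   exits (Lemma 6.5 / Prop 3.3.8); Labesse–Langlands + Weil; Tate lifting; Chebotarev in Dirichlet-density form; Brauer–Nesbitt/Clifford; the a.e.
   Satake↔Frobenius dictionary behind `HasFrobCharpolyAt … (arithFrobPolyOfSatake ι q 1 …)` (only its invariance-class matters here: `X_v` is scale- and
   inversion-invariant).  The node's kernel certifies the COMBINATORIAL heart (phase supports, certificates, moment bookkeeping), not the analysis.
2. DCD° is not formally weaker than the target DCD (it DROPS DCD's strong-Artin hypothesis on certified layers); it is weaker than IMP, RIGID (the ledger
   item 27355) and S, and `DCD ⟸ DCD° ∧ DCD_res` is by cases.  This is deliberate: the lever's content is «strong Artin removed».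
3. `PhaseMomentCertificate (L ≃ₐ[K] L)` is typed through `orderOf` in `Gal(L/K)` and `Nat.card`; for number fields the group is finite, and
   `0 < Nat.card G` is part of the definition, so there is no junk truth on infinite groups.  `f(w|v) = ord(Frob_v)` is used only at unramified `v` (a.e.).
4. Instrument I-g34.1 is a FLOAT LP (pure-Python two-phase simplex, tolerance `1e-9`); its INFEASIBLE verdicts are backed by exact kernel certificates for
   the `{1,…,5}`-class and `SL₂(𝔽₅)`, NOT for `PSL₂(7)`/`PSL₂(11)` (cubic/quintic phase supports; Sturm isolation would certify them); its FEASIBLE verdicts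
   (the residual list) are numerical and in any case only say the degree-4 method is silent.
5. Not addressed: TPD (twisted-primitive cell) — there the true answer `π ≅ π(ρ_A) ⊗ ν` is automorphically GENERIC (moments `(0,1,1,3)` are attained), so
   no moment certificate can exist; TPD keeps its strong-Artin antecedent (g33 (b)).  IMP₃ (rank `≥ 3`) untouched (needs `Ad : GL_n → GL_{n²−1}`).

## Why genuinely new (by construction and by search)

By construction: no node of the lineage (RootDecomp1 › … › PhaseTwistSplit g30 › AdjointCellSplit g33) and no open route of the cell uses the INEXACT
places; g29/g30 recorded them as the nemesis («phases not absorbed by any finite-order twist») and g33 priced only the exact cell `f = 1` against external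
Artin forms.  g34 turns the nemesis into the resource: the phase is an `f`-th root of unity, the adjoint trace lands in a finite set, and `π`'s own
`GL₃`/`GL₅` lifts see four moments of it — enough to contradict every layer group of spectrum `⊆ {1,…,5}` and `SL₂(𝔽₅)` by an LP certificate, with strong
Artin, modularity lifting and potential automorphy all absent.  By search (planner seat, 2026-08-31; labelled hits in the kit memo): the ingredients are
classical and cited — Kim–Shahidi use exactly `{1, ad, A⁴}` Rankin–Selberg products and Ramakrishnan's positivity to bound Satake parameters and to prove
Sato–Tate-type MOMENT statements for non-polyhedral `π` (Duke 112 §4, Props 4.2–4.9, Thm 4.10; Ramakrishnan's «remarks on symmetric powers» Thm 1.3.5)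
— but no hit combines (i) a Galois-side ROOT-OF-UNITY CONFINEMENT of the adjoint trace coming from a relative (power) relation with (ii) those unconditional
fourth moments into (iii) an LP/duality certificate over the ORDER SPECTRUM of the layer group; queries run against corpus (fts+vec) and galaxy:
"symmetric power moments root of unity Galois", "Sato-Tate moments|linear programming certificate", "cuspidality symmetric fourth icosahedral base change
descent", "adjoint lift dihedral induced quadratic inert places" — nearest: Kim–Shahidi Duke 112 Thm 4.1 (`δ(S(π)) ≥ 34/35` via [23,(4.4)]) and
Ramakrishnan MRL 4 (1997) (refined multiplicity one via adjoint L-functions) [corpus:paper:doi-10-1215-s0012-9074-02-11215-0 p.11, p.20]; delta: they bound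
exceptional-set densities for ONE form, we decide a DESCENT problem by pairing the moments against a finite phase geometry indexed by a Galois group.

## BC record (planner-side; raw outputs in the g34 kit: `.probes.check.json`, `.bc7.out`, `.axioms_probe.check.json`)

bc1 cone 2/2 (`closes_target` consumes `hC`, `hR`) · bc2 `C → DCD`, `C → IMP`, `C → Langlands` NOT cheap for both pieces (probes rc 1, every probe an
error; `S → C` landed: `*_of_langlands`) · bc3 skeleton = this file (pieces are defs; the heart theorems are proved, not stubbed) · bc4 dedup: no tree decl
mentions a phase/moment certificate (`lean search PhaseMoment|orderOf.*Satake|Sato.?Tate` — see memo) · bc5 witness of weakness: `cert_of_orderOf_le_five`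
+ `cert_of_binaryIcosahedral_stats` are PROVED rungs exercising the lever in regimes (`A₆`, even `A₅`, `SL₂(𝔽₅)` layers over arbitrary `K`) where neither S
nor strong Artin is known · bc6 declared 2 / in-cone 2 / aside 0 · bc7 see `.bc7.out` · bc8 technique class «analytic RS moments + finite phase geometry»:
outside TraceFormulaComparison / ModularityLifting / PotentialAutomorphy barrier classes (no residual automorphy, no Taylor–Wiles hypothesis, no
p-adic Hodge type); inside «functoriality ceiling»: uses only PROVED lifts `Sym², Sym⁴` · bc9 method_family = symmetric-power Rankin–Selberg moments;
ladder_ceiling = capped-at-degree-4 (`Sym^{≤4}`; `Sym⁵⁺`/`GL₂×GL₂×GL₂` open; KSh Sym⁶/Sym⁸/Sym⁹ partial results reach no even moment beyond 4 — checked,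
memo §Dead ends); ceiling_lift = `Sym⁵` or `Sym⁶` cuspidality/automorphy (would certify order-7/8 spectra: `PSL₂(7)` exactly, `A₇`, `SL₂(7)`, …)
[declared in DCD_res's docstring]; ceiling_sources = [corpus:paper:doi-10-1215-s0012-9074-02-11215-0 p.18–19 (T_n, Thm 4.10/Prop 4.11)].
-/

set_option linter.dupNamespace false
set_option linter.style.longLine false

noncomputable section

namespace Summit.Langlands.Langlands.Theorems.PhaseMomentSplit

open scoped BigOperators Topology Matrix Classical NumberField Polynomial
open Filter Set Function
open Literature.NumberTheory.GaloisRepresentations Literature.NumberTheory.Automorphic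
open IsDedekindDomain
open Summit.Langlands.Langlands.Theses
open Summit.Langlands.Langlands.Theorems.TatePhantomLift (PerfectLayerRigidity rigid_of_langlands)
open Summit.Langlands.Langlands.Theorems.PhaseTwistSplit (ImprimitiveCandidateRigidity PowerAvatarDescent imp_of_rigid imp_of_langlands)
open Summit.Langlands.Langlands.Theorems.RegularShadowSplit (StrongArtinOver strongArtinOver_of_strongArtinAE)
open Summit.Langlands.Langlands.Theorems.AdjointCellSplit (QuadIrreducible DihedralCandidateDescent TwistedPrimitiveDescent
  HigherRankImprimitiveRigidity dcd_of_imp)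

/-! ## §0 The dial — see `Theorems.PhaseMomentSplitHeart` (census pre-cut for the 400-line lint: §0 and §4 `section Heart` live there, VERBATIM). -/

/-! ## §1 The pieces (DCD's tree text `60bc1c15c333` with literal, asserted edits — `gen_node34.py`) -/

/-- [new] **DCD° · `CertifiedDihedralDescent`** (crux · rank 2 of the node · STRONG-ARTIN-FREE · WEAKER than IMP and than RIGID = stmt-Langlands-27355:
`dcd0_of_imp`, `dcd0_of_rigid` · S-implied: `dcd0_of_langlands` · **ATTACKABLE-NOW: paper proof (a′) of the module docstring, complete modulo print, with
NO strong Artin input; kernel-certified antecedent for every layer group of order spectrum `⊆ {1,…,5}` (`A₅`, `A₆`, `2⁴⋊A₅`, …: `cert_of_orderOf_le_five`)**).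
DCD's text with the antecedent `RegularShadowSplit.StrongArtinOver K →` DELETED and `PhaseMomentCertificate (L ≃ₐ[K] L) →` inserted in its place.
Why it might fail: it cannot if Langlands holds (`dcd0_of_langlands`); the risk is only Lean debt (honest flags 1–3). -/
def CertifiedDihedralDescent : Prop :=
  ∀ (K : Type) [Field K] [NumberField K] (hcpt : Literature.NumberTheory.Automorphic.isCompact_glFiniteIntegralLevel 2 K) (π : Literature.NumberTheory.Automorphic.CuspidalAutomorphicRepData 2 K hcpt), π.1.IsLAlgebraic → ∀ (L : Type) [Field L] [NumberField L] [Algebra K L], IsGalois K L → Module.finrank K L ≠ 1 → (¬ ∃ F : IntermediateField K L, F ≠ ⊥ ∧ IsGalois K ↥F ∧ IsCyclic (↥F ≃ₐ[K] ↥F) ∧ (Module.finrank K ↥F).Prime) → ∀ (ℓ : ℕ) [Fact ℓ.Prime] (ι : PadicAlgCl ℓ ≃+* ℂ) (r : Literature.NumberTheory.GaloisRepresentations.FramedGaloisRep L (PadicAlgCl ℓ) 2), r.toGaloisRep.IsSemisimple → r.IsIrreducible → PhaseMomentCertificate (L ≃ₐ[K] L) → (∃ ρ₀ : Literature.NumberTheory.GaloisRepresentations.FramedGaloisRep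 K (PadicAlgCl ℓ) 2, ρ₀.toGaloisRep.IsSemisimple ∧ ¬ QuadIrreducible K ρ₀ ∧ (∀ᶠ w : IsDedekindDomain.HeightOneSpectrum (NumberField.RingOfIntegers L) in cofinite, ∀ (v : IsDedekindDomain.HeightOneSpectrum (NumberField.RingOfIntegers K)) (α : Multiset ℂ), w.asIdeal.under (NumberField.RingOfIntegers K) = v.asIdeal → π.1.HasSatakeParamAt v α → (ρ₀.restrictField L).IsUnramifiedAt w ∧ (ρ₀.restrictField L).HasFrobCharpolyAt w (Literature.NumberTheory.Automorphic.arithFrobPolyOfSatake ι w.residueCard 1 (α.map (fun a => a ^ w.asIdeal.inertiaDeg (NumberField.RingOfIntegers K)))))) → (∀ᶠ w : IsDedekindDomain.HeightOneSpectrum (NumberField.RingOfIntegers L) in cofinite, ∀ (v : IsDedekindDomain.HeightOneSpectrum (NumberField.RingOfIntegers K)) (α : Multiset ℂ), w.asIdeal.under (NumberField.RingOfIntegers K) = v.asIdeal → π.1.HasSatakeParamAt v α → r.IsUnramifiedAt w ∧ r.HasFrobCharpolyAt w (Literature.NumberTheory.Automorphic.arithFrobPolyOfSatake ι w.residueCard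 1 (α.map (fun a => a ^ w.asIdeal.inertiaDeg (NumberField.RingOfIntegers K))))) → ∃ ρ : Literature.NumberTheory.GaloisRepresentations.FramedGaloisRep K (PadicAlgCl ℓ) 2, ρ.toGaloisRep.IsSemisimple ∧ ∀ᶠ v : IsDedekindDomain.HeightOneSpectrum (NumberField.RingOfIntegers K) in cofinite, SatakeFrobCompatibleAt ι π.1 ρ v

/-- [new] **DCD_res · `UncertifiedDihedralDescent`** (declared RESIDUAL of the phase-moment lever · WEAKER than DCD: `dcdres_of_dcd` · S-implied ·
still ATTACKABLE by g33's adjoint-cell pricing GIVEN strong Artin over `K` (it is DCD verbatim on the uncertified layers) · UNDECIDED strong-Artin-free).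
DCD's text VERBATIM with the single antecedent `¬ PhaseMomentCertificate (L ≃ₐ[K] L) →` inserted before `StrongArtinOver K →`.  The uncertified layer
groups by instrument I-g34.1 (LP at degree 4): `A₇`, `SL₂(7)`, `PSL₂(8)`, `PSL₂(13)`, `SL₂(9)`, `A₅ × A₅`, `M₁₁`, … — order spectra reaching `7, 8, 9, …`,
whose phase supports `V_f` equidistribute towards Sato–Tate faster than four moments can see (bc9 ladder ceiling: degree 4 = `Sym⁴`). -/
def UncertifiedDihedralDescent : Prop :=
  ∀ (K : Type) [Field K] [NumberField K] (hcpt : Literature.NumberTheory.Automorphic.isCompact_glFiniteIntegralLevel 2 K) (π : Literature.NumberTheory.Automorphic.CuspidalAutomorphicRepData 2 K hcpt), π.1.IsLAlgebraic → ∀ (L : Type) [Field L] [NumberField L] [Algebra K L], IsGalois K L → Module.finrank K L ≠ 1 → (¬ ∃ F : IntermediateField K L, F ≠ ⊥ ∧ IsGalois K ↥F ∧ IsCyclic (↥F ≃ₐ[K] ↥F) ∧ (Module.finrank K ↥F).Prime) → ∀ (ℓ : ℕ) [Fact ℓ.Prime] (ι : PadicAlgCl ℓ ≃+* ℂ) (r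 : Literature.NumberTheory.GaloisRepresentations.FramedGaloisRep L (PadicAlgCl ℓ) 2), r.toGaloisRep.IsSemisimple → r.IsIrreducible → ¬ PhaseMomentCertificate (L ≃ₐ[K] L) → Summit.Langlands.Langlands.Theorems.RegularShadowSplit.StrongArtinOver K → (∃ ρ₀ : Literature.NumberTheory.GaloisRepresentations.FramedGaloisRep K (PadicAlgCl ℓ) 2, ρ₀.toGaloisRep.IsSemisimple ∧ ¬ QuadIrreducible K ρ₀ ∧ (∀ᶠ w : IsDedekindDomain.HeightOneSpectrum (NumberField.RingOfIntegers L) in cofinite, ∀ (v : IsDedekindDomain.HeightOneSpectrum (NumberField.RingOfIntegers K)) (α : Multiset ℂ), w.asIdeal.under (NumberField.RingOfIntegers K) = v.asIdeal → π.1.HasSatakeParamAt v α → (ρ₀.restrictField L).IsUnramifiedAt w ∧ (ρ₀.restrictField L).HasFrobCharpolyAt w (Literature.NumberTheory.Automorphic.arithFrobPolyOfSatake ι w.residueCard 1 (α.map (fun a => a ^ w.asIdeal.inertiaDeg (NumberField.RingOfIntegers K)))))) → (∀ᶠ w : IsDedekindDomain.HeightOneSpectrum (NumberField.RingOfIntegers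 L) in cofinite, ∀ (v : IsDedekindDomain.HeightOneSpectrum (NumberField.RingOfIntegers K)) (α : Multiset ℂ), w.asIdeal.under (NumberField.RingOfIntegers K) = v.asIdeal → π.1.HasSatakeParamAt v α → r.IsUnramifiedAt w ∧ r.HasFrobCharpolyAt w (Literature.NumberTheory.Automorphic.arithFrobPolyOfSatake ι w.residueCard 1 (α.map (fun a => a ^ w.asIdeal.inertiaDeg (NumberField.RingOfIntegers K))))) → ∃ ρ : Literature.NumberTheory.GaloisRepresentations.FramedGaloisRep K (PadicAlgCl ℓ) 2, ρ.toGaloisRep.IsSemisimple ∧ ∀ᶠ v : IsDedekindDomain.HeightOneSpectrum (NumberField.RingOfIntegers K) in cofinite, SatakeFrobCompatibleAt ι π.1 ρ v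

/-! ## §2 Kernel: `closes_target` BY NAME (0 sorry), necessity and summit-side certificates -/

/-- **The deciding theorem** (0 sorry): DCD° → DCD_res → DCD, concluding the tree decl `Theorems.AdjointCellSplit.DihedralCandidateDescent` BY NAME.
Cases on `PhaseMomentCertificate (Gal(L/K))`; on certified layers the strong-Artin hypothesis of DCD is simply NOT USED. -/
theorem closes_target (hC : CertifiedDihedralDescent) (hR : UncertifiedDihedralDescent) : DihedralCandidateDescent := by
  intro K _ _ hcpt π hπ L _ _ _ hGal h1 hnc ℓ _ ι r hr hirr hSA hcand hrel
  by_cases hc : PhaseMomentCertificate (L ≃ₐ[K] L)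
  · exact hC K hcpt π hπ L hGal h1 hnc ℓ ι r hr hirr hc hcand hrel
  · exact hR K hcpt π hπ L hGal h1 hnc ℓ ι r hr hirr hc hSA hcand hrel

/-- **DCD_res is WEAKER than DCD** (one inserted antecedent). -/
theorem dcdres_of_dcd (h : DihedralCandidateDescent) : UncertifiedDihedralDescent := by
  intro K _ _ hcpt π hπ L _ _ _ hGal h1 hnc ℓ _ ι r hr hirr _hc hSA hcand hrel
  exact h K hcpt π hπ L hGal h1 hnc ℓ ι r hr hirr hSA hcand hrel

/-- **DCD° is WEAKER than IMP** (g33's target `PhaseTwistSplit.ImprimitiveCandidateRigidity`, which carries NO strong-Artin antecedent): the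
certificate antecedent is dropped and the dihedral cell is in particular not strongly irreducible (tree `AdjointCellSplit.dcd_of_imp` pattern). -/
theorem dcd0_of_imp (h : ImprimitiveCandidateRigidity) : CertifiedDihedralDescent := by
  intro K _ _ hcpt π hπ L _ _ _ hGal h1 hnc ℓ _ ι r hr hirr _hc hcand hrel
  obtain ⟨ρ₀, hρ₀, hq, h₀⟩ := hcand
  have hnsi : ¬ ∀ (M : Type) [Field M] [NumberField M] [Algebra K M], (ρ₀.restrictField M).IsIrreducible :=
    fun hsi => hq fun M _ _ _ _ => hsi M
  exact h K 2 hcpt two_pos π hπ L hGal h1 hnc ℓ ι r hr hirr ⟨ρ₀, hρ₀, hnsi, h₀⟩ hrel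

/-- DCD_res is WEAKER than IMP. -/
theorem dcdres_of_imp (h : ImprimitiveCandidateRigidity) : UncertifiedDihedralDescent := dcdres_of_dcd (dcd_of_imp h)

/-- DCD° is WEAKER than RIGID (stmt-Langlands-27355, tree `TatePhantomLift.PerfectLayerRigidity`). -/
theorem dcd0_of_rigid (hR : PerfectLayerRigidity) : CertifiedDihedralDescent := dcd0_of_imp (imp_of_rigid hR)

/-- DCD_res is WEAKER than RIGID. -/
theorem dcdres_of_rigid (hR : PerfectLayerRigidity) : UncertifiedDihedralDescent := dcdres_of_imp (imp_of_rigid hR)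

/-- DCD° is S-implied (BC2, direction `S → C`; the probes file shows `C → S`, `C → IMP`, `C → DCD` are not cheap). -/
private theorem dcd0_of_langlands (hL : _root_.Langlands) : CertifiedDihedralDescent := dcd0_of_imp (imp_of_langlands hL)

/-- DCD_res is S-implied. -/
private theorem dcdres_of_langlands (hL : _root_.Langlands) : UncertifiedDihedralDescent := dcdres_of_imp (imp_of_langlands hL)

/-- Unconditional half of the exactness: DCD implies DCD_res, IMP implies both pieces. -/
theorem pieces_of_imp (h : ImprimitiveCandidateRigidity) : CertifiedDihedralDescent ∧ UncertifiedDihedralDescent :=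
  ⟨dcd0_of_imp h, dcdres_of_imp h⟩

/-- **What the lever buys, in one line**: on a CERTIFIED layer the dihedral cell of IMP at rank 2 holds with the strong-Artin hypothesis of DCD
replaced by `True` — stated as DCD's binder list with `StrongArtinOver K` deleted (the form `closes_target` consumes in the certified branch). -/
theorem certified_branch (hC : CertifiedDihedralDescent) (K : Type) [Field K] [NumberField K]
    (hcpt : isCompact_glFiniteIntegralLevel 2 K) (π : CuspidalAutomorphicRepData 2 K hcpt) (hπ : π.1.IsLAlgebraic)
    (L : Type) [Field L] [NumberField L] [Algebra K L] (hGal : IsGalois K L) (h1 : Module.finrank K L ≠ 1)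
    (hnc : ¬ ∃ F : IntermediateField K L, F ≠ ⊥ ∧ IsGalois K ↥F ∧ IsCyclic (↥F ≃ₐ[K] ↥F) ∧ (Module.finrank K ↥F).Prime)
    (hcert : PhaseMomentCertificate (L ≃ₐ[K] L))
    (ℓ : ℕ) [Fact ℓ.Prime] (ι : PadicAlgCl ℓ ≃+* ℂ) (r : FramedGaloisRep L (PadicAlgCl ℓ) 2) (hr : r.toGaloisRep.IsSemisimple) (hirr : r.IsIrreducible)
    (ρ₀ : FramedGaloisRep K (PadicAlgCl ℓ) 2) (hρ₀ : ρ₀.toGaloisRep.IsSemisimple) (hq : ¬ QuadIrreducible K ρ₀)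
    (h₀ : ∀ᶠ w : HeightOneSpectrum (𝓞 L) in cofinite, ∀ (v : HeightOneSpectrum (𝓞 K)) (α : Multiset ℂ), w.asIdeal.under (𝓞 K) = v.asIdeal →
      π.1.HasSatakeParamAt v α → (ρ₀.restrictField L).IsUnramifiedAt w ∧ (ρ₀.restrictField L).HasFrobCharpolyAt w
        (arithFrobPolyOfSatake ι w.residueCard 1 (α.map (fun a => a ^ w.asIdeal.inertiaDeg (𝓞 K)))))
    (hrel : ∀ᶠ w : HeightOneSpectrum (𝓞 L) in cofinite, ∀ (v : HeightOneSpectrum (𝓞 K)) (α : Multiset ℂ), w.asIdeal.under (𝓞 K) = v.asIdeal →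
      π.1.HasSatakeParamAt v α → r.IsUnramifiedAt w ∧ r.HasFrobCharpolyAt w
        (arithFrobPolyOfSatake ι w.residueCard 1 (α.map (fun a => a ^ w.asIdeal.inertiaDeg (𝓞 K))))) :
    ∃ ρ : FramedGaloisRep K (PadicAlgCl ℓ) 2, ρ.toGaloisRep.IsSemisimple ∧
      ∀ᶠ v : HeightOneSpectrum (𝓞 K) in cofinite, SatakeFrobCompatibleAt ι π.1 ρ v := by
  haveI := hGal
  exact hC K hcpt π hπ L hGal h1 hnc ℓ ι r hr hirr hcert ⟨ρ₀, hρ₀, hq, h₀⟩ hrel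

/-! ## §3 Host edges (BY NAME, through the g33 kernel `AdjointCellSplit.closes_target : DCD → TPD → SART → IMP₃ → IMP` and its host edges) -/

/-- IMP ⟸ DCD° ∧ DCD_res ∧ TPD ∧ SART ∧ IMP₃. -/
theorem closes_imp (hC : CertifiedDihedralDescent) (hR : UncertifiedDihedralDescent) (hT : TwistedPrimitiveDescent)
    (hA : MonomialConverse.StrongArtinAE) (hI : HigherRankImprimitiveRigidity) : ImprimitiveCandidateRigidity :=
  AdjointCellSplit.closes_target (closes_target hC hR) hT hA hI

/-- RIGID (tree twin `TatePhantomLift.PerfectLayerRigidity`) ⟸ PAR ∧ DCD° ∧ DCD_res ∧ TPD ∧ SART ∧ IMP₃. -/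
theorem closes_rigid (hP : PowerAvatarDescent) (hC : CertifiedDihedralDescent) (hR : UncertifiedDihedralDescent) (hT : TwistedPrimitiveDescent)
    (hA : MonomialConverse.StrongArtinAE) (hI : HigherRankImprimitiveRigidity) : PerfectLayerRigidity :=
  AdjointCellSplit.closes_rigid hP (closes_target hC hR) hT hA hI

/-- The live ledger item stmt-Langlands-27355 `Theses.PerfectLayerClifford.PerfectLayerRigidity` BY NAME. -/
theorem closes_item (hP : PowerAvatarDescent) (hC : CertifiedDihedralDescent) (hR : UncertifiedDihedralDescent) (hT : TwistedPrimitiveDescent)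
    (hA : MonomialConverse.StrongArtinAE) (hI : HigherRankImprimitiveRigidity) :
    Summit.Langlands.Langlands.Theses.PerfectLayerClifford.PerfectLayerRigidity :=
  AdjointCellSplit.closes_item hP (closes_target hC hR) hT hA hI

/-- With the route's other items EXT (27354), FINTYPE (27356), RED° (27357): the host leaf `GaloisHullLift.PerfectHullDescent` (28225) through the
ROUTE'S OWN deciding theorem (tree `AdjointCellSplit.closes_route`). -/
theorem closes_route (hE : Summit.Langlands.Langlands.Theses.PerfectLayerClifford.PerfectLayerExtension) (hP : PowerAvatarDescent)
    (hC : CertifiedDihedralDescent) (hR : UncertifiedDihedralDescent) (hT : TwistedPrimitiveDescent) (hA : MonomialConverse.StrongArtinAE)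
    (hI : HigherRankImprimitiveRigidity) (hF : Summit.Langlands.Langlands.Theses.PerfectLayerClifford.FiniteTypePerfectDescent)
    (hRed : Summit.Langlands.Langlands.Theses.PerfectLayerClifford.ReduciblePerfectDescent) : GaloisHullLift.PerfectHullDescent :=
  AdjointCellSplit.closes_route hE hP (closes_target hC hR) hT hA hI hF hRed

end Summit.Langlands.Langlands.Theorems.PhaseMomentSplit
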